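import Literature.NumberTheory.Rogawski1990.LocalTransferTorusUnstableJunctionCM        -- ★ p842095 B-p08 (g27): the `hR1` junction whose binder `halt` this file reads (→ ★ p841663 grammar)
import Literature.NumberTheory.Rogawski1990.FinExplicitTransferFactorKappaSumZero          -- ★ p842405 FILE A (this seat): (ALL) `Σ_c Δ‴_v(↑t, out c) = 0` at every G-regular torus point
import HarnessLib

/-!
# THE κ-ALTERNATION ON THE COMPACT SIDE AT AN `H`-REGULAR TORUS POINT — the binder `hΔ0` of ★ `exists_nhds_finsum_side_eq_zero_of_compact_dock` by «ALL − GOOD»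
# (Rogawski 1990 Prop. 8.2.1 (c), §4.3 (4.3.2); Labesse–Langlands 1979 §2; Langlands–Shelstad descent §2.4)

Topic `NumberTheory/Rogawski1990`; namespace `Literature.NumberTheory.Rogawski1990`.  THEOREMS ONLY (no definition, no instance, no notation, no named fact, no `sorry`).
Cell `pub/hodgecm-mathlib` (D-0151), crux H413 = stmt-HodgeConjecture-24833, floor-2 line «N6nsGerm», stub `stub_N6nsS2`; LEAD F0P3a-plan (g9) WORD T8-149 (c′) → F0P3-p01 (g13),
FILE B.  Consumer: A-p19 (g22)'s S2 DRESS ∕ the ED. 1.5 fold — the residual `hI0` of ★ p841663 is ★ `exists_nhds_finsum_side_eq_zero_of_compact_dock … hD0′ hΔ0` (p842308), and THIS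
file pays `hΔ0` from binders the dress already holds: `hsep′`, `hside`, `hdisj` (★ p841663's, VERBATIM), `halt` (★ p842095's, VERBATIM — F0P3-p02 (g12)'s (J2a) head discharges it),
and (ALL) `hall` — ★ FILE A `FinExplicitTransferFactorKappaSumZero` (`finsum_finExplicitCollection_Δ_coe_out_eq_zero_of_torusFrame`: at EVERY `G`-regular torus point,
so `Va := univ`): kept as a binder in §1 and DISCHARGED in §2 over the (T) eigenframe tokens `P dg hP hdg0 hdg01` of ★ `exists_torusTransport_frame`.
HONEST LABEL: HC_CM is proved only modulo the printed citations (2 remaining named inputs hLiu418, h413) until rung 0 closes; this file is bookkeeping over ★ modules and pays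
nothing printed by itself.

THE MATHEMATICS.  At `t` near the base point `b₀` of the torus `Z_{H_v}(ε_H)` with `↑t` `G`-regular, every class `c` of `G′_v` MATCHED with `↑t` is either docked-good
(`x·(out c)·x⁻¹ = θ h` with `h ∼_st τ t`; `hside`) or on the bad side `Q′ t (out c)`, never both (`hdisj`).  By `halt` the `H_v`-stable class of `τ t` is `{⟦τ t⟧, d′}`, so the
good classes are among `{⟦θ(out ⟦τ t⟧)⟧, ⟦θ(out d′)⟧}` (`θ` carries `H_v`-conjugacy to `G′_v`-conjugacy); these two are DISTINCT by (SEP′) on its stably saturated window (reached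
through `τ`, continuous with `τ b₀ = ε♭`), both good, and `Δ‴_v(↑t, ·)` takes OPPOSITE values on them (`halt`, class invariance `hr`); a good class off the match set carries `Δ‴_v = 0`.
Hence `Σ_{good ∩ matched} Δ‴_v(↑t, out c) = Δ‴_v(↑t, θ(out ⟦τ t⟧)) + Δ‴_v(↑t, θ(out d′)) = 0`, and with (ALL) `Σ_{matched} Δ‴_v = 0`:
`Σ_{Q′ ∩ matched} Δ‴_v(↑t, out c) = Σ_{matched} − Σ_{good ∩ matched} = 0` — the two compact-side classes carry opposite `κ_v`, with no anisotropic-plane class theory.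

* §1 **`exists_nhds_finsum_badSide_delta_eq_zero`** — the junction (abstract `Q′`, `hall` as a binder).
* §2 **`exists_nhds_finsum_badSide_delta_eq_zero_of_torusFrame`** — the same with `hall` discharged by ★ FILE A over `(w hw) (hH′ hdet′) (P dg hP hdg0 hdg01)`.

## References
* [Rogawski1990] J. D. Rogawski, *Automorphic Representations of Unitary Groups in Three Variables*, Ann. of Math. Stud. 123 (1990): §8.2 Prop. 8.2.1 (c) pp. 113–115; §4.3 (4.3.1)–(4.3.2)
  p. 43; §3.5 Prop. 3.5.2 (c) p. 29.
* [LabesseLanglands1979] J.-P. Labesse, R. P. Langlands, *L-indistinguishability for SL(2)*, Canad. J. Math. 31 (1979): §2.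
* [LanglandsShelstad1990Descent] R. P. Langlands, D. Shelstad, *Descent for transfer factors* (1990): §2.4.
-/

set_option autoImplicit false

noncomputable section

open Set Filter Topology
open scoped Matrix MatrixGroups

namespace Literature.NumberTheory.Rogawski1990

open Literature.NumberTheory.Automorphic Literature.NumberTheory.Automorphic.UnitaryGroup Literature.NumberTheory.GaloisRepresentations
open _root_.NumberField _root_.IsDedekindDomain

section BadSide

variable (L : Type) [Field L] [NumberField L] [IsCMField L] (H' : Matrix (Fin 3) (Fin 3) L) (v : HeightOneSpectrum (𝓞 ↥(maximalRealSubfield L)))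

set_option maxHeartbeats 400000 in
-- 2× default: ONE assembly theorem whose binder telescope (dock, centralisers, two class types) and `set` bookkeeping exhaust the default budget at `whnf` (★ p842138 ∕ ★ p841669 precedent)
/-- **THE `Δ‴_v`-SUM OVER THE MATCHED BAD-SIDE CLASSES VANISHES NEAR AN `H`-REGULAR TORUS BASE POINT** (`hΔ0` of ★ `exists_nhds_finsum_side_eq_zero_of_compact_dock` by
«ALL − GOOD»).  Data: the explicit factor `Δ‴_v` (`μ hl hr`); the point `ε_H`, its torus `Z_{H_v}(ε_H)` with base point `b₀`; the dock `θ : H_v ≃ₜ* Z_{G′_v}(ε)`, the transported base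
`ε♭` and the torus transport `τ` (`hτc`, `hτ₀`); the abstract bad side `Q′ : ↥Z(ε_H) → G′_v → Prop`.  Binders: (SEP′) `hsep′`, the sided fibre `hside`, the disjointness `hdisj` —
★ `exists_nhds_stableOrbitalIntegralRel_eq_of_torus_singular_inv`'s, VERBATIM; (J2a) `halt` — ★ `exists_nhds_finsum_delta_dock_eq_locallyConstant_of_torusTransfer`'s, VERBATIM;
(ALL) `hall` — FILE A.  CONCLUSION = the `hΔ0` binder VERBATIM: near `b₀`, `Σᶠ_{c : Q′ t (out c) ∧ matched} Δ‴_v(↑t, out c) = 0`.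
[cite: Rogawski1990, §8.2 Prop. 8.2.1 (c) pp. 113–115; §4.3 (4.3.2) p. 43] [cite: LabesseLanglands1979, §2] [cite: LanglandsShelstad1990Descent, §2.4] -/
theorem exists_nhds_finsum_badSide_delta_eq_zero (μ : HeckeCharacter L)
    (hl : ∀ (v : HeightOneSpectrum (𝓞 ↥(maximalRealSubfield L))) (a : ((cmDatum L 2 (Matrix.of fun i j : Fin 2 => if i.val + j.val + 1 = 2 then (1 : L) else 0)).Local v ×
      (cmDatum L 1 (Matrix.of fun i j : Fin 1 => if i.val + j.val + 1 = 1 then (1 : L) else 0)).Local v)) (b : (cmDatum L 3 H').Local v) (x : ((cmDatum L 2 (Matrix.of fun i j : Fin 2 => if i.val + j.val + 1 = 2 then (1 : L) else 0)).Local v ×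
      (cmDatum L 1 (Matrix.of fun i j : Fin 1 => if i.val + j.val + 1 = 1 then (1 : L) else 0)).Local v)),
      finExplicitDelta L v H' (x * a * x⁻¹) μ b = finExplicitDelta L v H' a μ b)
    (hr : ∀ (v : HeightOneSpectrum (𝓞 ↥(maximalRealSubfield L))) (a : ((cmDatum L 2 (Matrix.of fun i j : Fin 2 => if i.val + j.val + 1 = 2 then (1 : L) else 0)).Local v ×
      (cmDatum L 1 (Matrix.of fun i j : Fin 1 => if i.val + j.val + 1 = 1 then (1 : L) else 0)).Local v)) (b y : (cmDatum L 3 H').Local v),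
      finExplicitDelta L v H' a μ (y * b * y⁻¹) = finExplicitDelta L v H' a μ b)
    (εH : ((cmDatum L 2 (Matrix.of fun i j : Fin 2 => if i.val + j.val + 1 = 2 then (1 : L) else 0)).Local v ×
      (cmDatum L 1 (Matrix.of fun i j : Fin 1 => if i.val + j.val + 1 = 1 then (1 : L) else 0)).Local v)) (b₀ : ↥(Subgroup.centralizer ({εH} : Set ((cmDatum L 2 (Matrix.of fun i j : Fin 2 => if i.val + j.val + 1 = 2 then (1 : L) else 0)).Local v ×
      (cmDatum L 1 (Matrix.of fun i j : Fin 1 => if i.val + j.val + 1 = 1 then (1 : L) else 0)).Local v))))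
    (ε : (cmDatum L 3 H').Local v) (θ : ((cmDatum L 2 (Matrix.of fun i j : Fin 2 => if i.val + j.val + 1 = 2 then (1 : L) else 0)).Local v ×
      (cmDatum L 1 (Matrix.of fun i j : Fin 1 => if i.val + j.val + 1 = 1 then (1 : L) else 0)).Local v) ≃ₜ* ↥(Subgroup.centralizer ({ε} : Set ((cmDatum L 3 H').Local v))))
    (εf : ((cmDatum L 2 (Matrix.of fun i j : Fin 2 => if i.val + j.val + 1 = 2 then (1 : L) else 0)).Local v ×
      (cmDatum L 1 (Matrix.of fun i j : Fin 1 => if i.val + j.val + 1 = 1 then (1 : L) else 0)).Local v)) (τ : ↥(Subgroup.centralizer ({εH} : Set ((cmDatum L 2 (Matrix.of fun i j : Fin 2 => if i.val + j.val + 1 = 2 then (1 : L) else 0)).Local v ×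
      (cmDatum L 1 (Matrix.of fun i j : Fin 1 => if i.val + j.val + 1 = 1 then (1 : L) else 0)).Local v))) → ((cmDatum L 2 (Matrix.of fun i j : Fin 2 => if i.val + j.val + 1 = 2 then (1 : L) else 0)).Local v ×
      (cmDatum L 1 (Matrix.of fun i j : Fin 1 => if i.val + j.val + 1 = 1 then (1 : L) else 0)).Local v)) (hτc : Continuous τ) (hτ₀ : τ b₀ = εf)
    (Q' : ↥(Subgroup.centralizer ({εH} : Set ((cmDatum L 2 (Matrix.of fun i j : Fin 2 => if i.val + j.val + 1 = 2 then (1 : L) else 0)).Local v ×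
      (cmDatum L 1 (Matrix.of fun i j : Fin 1 => if i.val + j.val + 1 = 1 then (1 : L) else 0)).Local v))) → (cmDatum L 3 H').Local v → Prop)
    -- (SEP′) transported, on a STABLY SATURATED window (★ p841663's binder, verbatim)
    (hsep' : ∃ B₇ ∈ 𝓝 εf, (∀ h ∈ B₇, ∀ h' : ((cmDatum L 2 (Matrix.of fun i j : Fin 2 => if i.val + j.val + 1 = 2 then (1 : L) else 0)).Local v ×
      (cmDatum L 1 (Matrix.of fun i j : Fin 1 => if i.val + j.val + 1 = 1 then (1 : L) else 0)).Local v), IsLocalStablyConjH L v h h' → h' ∈ B₇) ∧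
      ∀ h ∈ B₇, ∀ h' ∈ B₇, ∀ x : (cmDatum L 3 H').Local v, x * ((θ h : ↥(Subgroup.centralizer ({ε} : Set ((cmDatum L 3 H').Local v)))) : (cmDatum L 3 H').Local v) * x⁻¹ = ((θ h' : ↥(Subgroup.centralizer ({ε} : Set ((cmDatum L 3 H').Local v)))) : (cmDatum L 3 H').Local v) → IsConj h h')
    -- (U-s″) the SIDED uniform fibre (★ p841663's binder, verbatim)
    (hside : ∃ V₃ ∈ 𝓝 b₀, ∀ t ∈ V₃, IsLocalGRegular L v (t : ((cmDatum L 2 (Matrix.of fun i j : Fin 2 => if i.val + j.val + 1 = 2 then (1 : L) else 0)).Local v ×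
      (cmDatum L 1 (Matrix.of fun i j : Fin 1 => if i.val + j.val + 1 = 1 then (1 : L) else 0)).Local v)) → ∀ γ' : (cmDatum L 3 H').Local v, IsLocalNormPair L H' v (t : ((cmDatum L 2 (Matrix.of fun i j : Fin 2 => if i.val + j.val + 1 = 2 then (1 : L) else 0)).Local v ×
      (cmDatum L 1 (Matrix.of fun i j : Fin 1 => if i.val + j.val + 1 = 1 then (1 : L) else 0)).Local v)) γ' →
      (∃ x : (cmDatum L 3 H').Local v, ∃ h : ((cmDatum L 2 (Matrix.of fun i j : Fin 2 => if i.val + j.val + 1 = 2 then (1 : L) else 0)).Local v ×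
      (cmDatum L 1 (Matrix.of fun i j : Fin 1 => if i.val + j.val + 1 = 1 then (1 : L) else 0)).Local v), IsLocalStablyConjH L v (τ t) h ∧ x * γ' * x⁻¹ = ((θ h : ↥(Subgroup.centralizer ({ε} : Set ((cmDatum L 3 H').Local v)))) : (cmDatum L 3 H').Local v)) ∨ Q' t γ')
    -- the two sides never meet (★ p841663's binder, verbatim)
    (hdisj : ∃ V₀ ∈ 𝓝 b₀, ∀ t ∈ V₀, ∀ γ' : (cmDatum L 3 H').Local v,
      (∃ x : (cmDatum L 3 H').Local v, ∃ h : ((cmDatum L 2 (Matrix.of fun i j : Fin 2 => if i.val + j.val + 1 = 2 then (1 : L) else 0)).Local v ×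
      (cmDatum L 1 (Matrix.of fun i j : Fin 1 => if i.val + j.val + 1 = 1 then (1 : L) else 0)).Local v), IsLocalStablyConjH L v (τ t) h ∧ x * γ' * x⁻¹ = ((θ h : ↥(Subgroup.centralizer ({ε} : Set ((cmDatum L 3 H').Local v)))) : (cmDatum L 3 H').Local v)) → Q' t γ' → False)
    -- (J2a) κ-alternation at the torus base (★ p842095's binder, verbatim)
    (halt : ∃ V₁ ∈ 𝓝 b₀, ∀ t ∈ V₁, IsLocalGRegular L v (t : ((cmDatum L 2 (Matrix.of fun i j : Fin 2 => if i.val + j.val + 1 = 2 then (1 : L) else 0)).Local v ×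
      (cmDatum L 1 (Matrix.of fun i j : Fin 1 => if i.val + j.val + 1 = 1 then (1 : L) else 0)).Local v)) → ∃ d' : ConjClasses ((cmDatum L 2 (Matrix.of fun i j : Fin 2 => if i.val + j.val + 1 = 2 then (1 : L) else 0)).Local v ×
      (cmDatum L 1 (Matrix.of fun i j : Fin 1 => if i.val + j.val + 1 = 1 then (1 : L) else 0)).Local v), d' ≠ ConjClasses.mk (τ t) ∧
        {d : ConjClasses ((cmDatum L 2 (Matrix.of fun i j : Fin 2 => if i.val + j.val + 1 = 2 then (1 : L) else 0)).Local v ×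
      (cmDatum L 1 (Matrix.of fun i j : Fin 1 => if i.val + j.val + 1 = 1 then (1 : L) else 0)).Local v) | IsLocalStablyConjH L v (τ t) (Quotient.out d)} = {ConjClasses.mk (τ t), d'} ∧
        ((finExplicitCollection L H' μ hl hr) v).Δ (t : ((cmDatum L 2 (Matrix.of fun i j : Fin 2 => if i.val + j.val + 1 = 2 then (1 : L) else 0)).Local v ×
      (cmDatum L 1 (Matrix.of fun i j : Fin 1 => if i.val + j.val + 1 = 1 then (1 : L) else 0)).Local v)) ((θ (Quotient.out d') : ↥(Subgroup.centralizer ({ε} : Set ((cmDatum L 3 H').Local v)))) : (cmDatum L 3 H').Local v) =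
          - ((finExplicitCollection L H' μ hl hr) v).Δ (t : ((cmDatum L 2 (Matrix.of fun i j : Fin 2 => if i.val + j.val + 1 = 2 then (1 : L) else 0)).Local v ×
      (cmDatum L 1 (Matrix.of fun i j : Fin 1 => if i.val + j.val + 1 = 1 then (1 : L) else 0)).Local v)) ((θ (Quotient.out (ConjClasses.mk (τ t))) : ↥(Subgroup.centralizer ({ε} : Set ((cmDatum L 3 H').Local v)))) : (cmDatum L 3 H').Local v))
    -- (ALL) the total `Δ‴_v`-weighted class count vanishes and the matched classes are finite (FILE A)
    (hall : ∃ Va ∈ 𝓝 b₀, ∀ t ∈ Va, IsLocalGRegular L v (t : ((cmDatum L 2 (Matrix.of fun i j : Fin 2 => if i.val + j.val + 1 = 2 then (1 : L) else 0)).Local v ×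
      (cmDatum L 1 (Matrix.of fun i j : Fin 1 => if i.val + j.val + 1 = 1 then (1 : L) else 0)).Local v)) →
      {c : ConjClasses ((cmDatum L 3 H').Local v) | IsLocalNormPair L H' v (t : ((cmDatum L 2 (Matrix.of fun i j : Fin 2 => if i.val + j.val + 1 = 2 then (1 : L) else 0)).Local v ×
      (cmDatum L 1 (Matrix.of fun i j : Fin 1 => if i.val + j.val + 1 = 1 then (1 : L) else 0)).Local v)) (Quotient.out c)}.Finite ∧
        ∑ᶠ c : ConjClasses ((cmDatum L 3 H').Local v), ((finExplicitCollection L H' μ hl hr) v).Δ (t : ((cmDatum L 2 (Matrix.of fun i j : Fin 2 => if i.val + j.val + 1 = 2 then (1 : L) else 0)).Local v ×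
      (cmDatum L 1 (Matrix.of fun i j : Fin 1 => if i.val + j.val + 1 = 1 then (1 : L) else 0)).Local v)) (Quotient.out c) = 0) :
    ∃ V ∈ 𝓝 b₀, ∀ t ∈ V, IsLocalGRegular L v (t : ((cmDatum L 2 (Matrix.of fun i j : Fin 2 => if i.val + j.val + 1 = 2 then (1 : L) else 0)).Local v ×
      (cmDatum L 1 (Matrix.of fun i j : Fin 1 => if i.val + j.val + 1 = 1 then (1 : L) else 0)).Local v)) →
      (∑ᶠ c ∈ {c : ConjClasses ((cmDatum L 3 H').Local v) | Q' t (Quotient.out c) ∧ IsLocalNormPair L H' v (t : ((cmDatum L 2 (Matrix.of fun i j : Fin 2 => if i.val + j.val + 1 = 2 then (1 : L) else 0)).Local v ×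
      (cmDatum L 1 (Matrix.of fun i j : Fin 1 => if i.val + j.val + 1 = 1 then (1 : L) else 0)).Local v)) (Quotient.out c)},
        ((finExplicitCollection L H' μ hl hr) v).Δ (t : ((cmDatum L 2 (Matrix.of fun i j : Fin 2 => if i.val + j.val + 1 = 2 then (1 : L) else 0)).Local v ×
      (cmDatum L 1 (Matrix.of fun i j : Fin 1 => if i.val + j.val + 1 = 1 then (1 : L) else 0)).Local v)) (Quotient.out c)) = 0 := by
  classical
  obtain ⟨B₇, hB₇, hB₇sat, hsep⟩ := hsep'
  obtain ⟨V₃, hV₃, hsd⟩ := hside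
  obtain ⟨V₀, hV₀, hdj⟩ := hdisj
  obtain ⟨V₁, hV₁, hal⟩ := halt
  obtain ⟨Va, hVa, hal'⟩ := hall
  have hτB : τ ⁻¹' B₇ ∈ 𝓝 b₀ := hτc.continuousAt.preimage_mem_nhds (by rw [hτ₀]; exact hB₇)
  refine ⟨V₃ ∩ V₀ ∩ V₁ ∩ Va ∩ τ ⁻¹' B₇, inter_mem (inter_mem (inter_mem (inter_mem hV₃ hV₀) hV₁) hVa) hτB, fun t ht htreg => ?_⟩
  obtain ⟨⟨⟨⟨ht₃, ht₀⟩, ht₁⟩, hta⟩, htB⟩ := ht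
  obtain ⟨hfin, hsum⟩ := hal' t hta htreg
  obtain ⟨d', hd'ne, hset, hΔneg⟩ := hal t ht₁ htreg
  -- the summand as a function of the class, and its class invariance
  set F : ConjClasses ((cmDatum L 3 H').Local v) → ℂ := fun c => ((finExplicitCollection L H' μ hl hr) v).Δ (t : ((cmDatum L 2 (Matrix.of fun i j : Fin 2 => if i.val + j.val + 1 = 2 then (1 : L) else 0)).Local v ×
      (cmDatum L 1 (Matrix.of fun i j : Fin 1 => if i.val + j.val + 1 = 1 then (1 : L) else 0)).Local v)) (Quotient.out c) with hF
  have hinv : ∀ (γ z : (cmDatum L 3 H').Local v), ((finExplicitCollection L H' μ hl hr) v).Δ (t : ((cmDatum L 2 (Matrix.of fun i j : Fin 2 => if i.val + j.val + 1 = 2 then (1 : L) else 0)).Local v ×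
      (cmDatum L 1 (Matrix.of fun i j : Fin 1 => if i.val + j.val + 1 = 1 then (1 : L) else 0)).Local v)) (z * γ * z⁻¹) = ((finExplicitCollection L H' μ hl hr) v).Δ (t : ((cmDatum L 2 (Matrix.of fun i j : Fin 2 => if i.val + j.val + 1 = 2 then (1 : L) else 0)).Local v ×
      (cmDatum L 1 (Matrix.of fun i j : Fin 1 => if i.val + j.val + 1 = 1 then (1 : L) else 0)).Local v)) γ := fun γ z => by
    rw [finExplicitCollection_Δ, finExplicitCollection_Δ, hr]
  have hout : ∀ γ : (cmDatum L 3 H').Local v, ∃ z : (cmDatum L 3 H').Local v, z * γ * z⁻¹ = Quotient.out (ConjClasses.mk γ) := fun γ =>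
    isConj_iff.1 (ConjClasses.mk_eq_mk_iff_isConj.1
      (show ConjClasses.mk (Quotient.out (ConjClasses.mk γ)) = ConjClasses.mk γ by rw [← ConjClasses.quotient_mk_eq_mk, Quotient.out_eq]).symm)
  have hFmk : ∀ γ : (cmDatum L 3 H').Local v, F (ConjClasses.mk γ) = ((finExplicitCollection L H' μ hl hr) v).Δ (t : ((cmDatum L 2 (Matrix.of fun i j : Fin 2 => if i.val + j.val + 1 = 2 then (1 : L) else 0)).Local v ×
      (cmDatum L 1 (Matrix.of fun i j : Fin 1 => if i.val + j.val + 1 = 1 then (1 : L) else 0)).Local v)) γ := fun γ => by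
    obtain ⟨z, hz⟩ := hout γ
    simp only [hF]
    rw [← hz, hinv]
  -- `H_v`-side: representatives of classes, stable conjugacy is class-invariant
  have houtH : ∀ h : ((cmDatum L 2 (Matrix.of fun i j : Fin 2 => if i.val + j.val + 1 = 2 then (1 : L) else 0)).Local v ×
      (cmDatum L 1 (Matrix.of fun i j : Fin 1 => if i.val + j.val + 1 = 1 then (1 : L) else 0)).Local v), ∃ z : ((cmDatum L 2 (Matrix.of fun i j : Fin 2 => if i.val + j.val + 1 = 2 then (1 : L) else 0)).Local v ×
      (cmDatum L 1 (Matrix.of fun i j : Fin 1 => if i.val + j.val + 1 = 1 then (1 : L) else 0)).Local v), z * h * z⁻¹ = Quotient.out (ConjClasses.mk h) := fun h =>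
    isConj_iff.1 (ConjClasses.mk_eq_mk_iff_isConj.1
      (show ConjClasses.mk (Quotient.out (ConjClasses.mk h)) = ConjClasses.mk h by rw [← ConjClasses.quotient_mk_eq_mk, Quotient.out_eq]).symm)
  have hstout : ∀ h : ((cmDatum L 2 (Matrix.of fun i j : Fin 2 => if i.val + j.val + 1 = 2 then (1 : L) else 0)).Local v ×
      (cmDatum L 1 (Matrix.of fun i j : Fin 1 => if i.val + j.val + 1 = 1 then (1 : L) else 0)).Local v), IsLocalStablyConjH L v (τ t) h → IsLocalStablyConjH L v (τ t) (Quotient.out (ConjClasses.mk h)) := fun h hst => by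
    obtain ⟨z, hz⟩ := houtH h
    rw [← hz]
    exact IsStablyConjH.trans hst (isStablyConjH_of_isConj (isConj_iff.2 ⟨z, rfl⟩))
  -- `θ` carries `H_v`-conjugacy to `G′_v`-conjugacy
  have hθconj : ∀ h h' : ((cmDatum L 2 (Matrix.of fun i j : Fin 2 => if i.val + j.val + 1 = 2 then (1 : L) else 0)).Local v ×
      (cmDatum L 1 (Matrix.of fun i j : Fin 1 => if i.val + j.val + 1 = 1 then (1 : L) else 0)).Local v), IsConj h h' → IsConj ((θ h : ↥(Subgroup.centralizer ({ε} : Set ((cmDatum L 3 H').Local v)))) : (cmDatum L 3 H').Local v) ((θ h' : ↥(Subgroup.centralizer ({ε} : Set ((cmDatum L 3 H').Local v)))) : (cmDatum L 3 H').Local v) := by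
    intro h h' hc
    obtain ⟨c, hc⟩ := isConj_iff.1 hc
    refine isConj_iff.2 ⟨((θ c : ↥(Subgroup.centralizer ({ε} : Set ((cmDatum L 3 H').Local v)))) : (cmDatum L 3 H').Local v), ?_⟩
    rw [← hc, map_mul, map_mul, map_inv, Subgroup.coe_mul, Subgroup.coe_mul, Subgroup.coe_inv]
  -- the two good classes and their base elements
  set h₁ : ((cmDatum L 2 (Matrix.of fun i j : Fin 2 => if i.val + j.val + 1 = 2 then (1 : L) else 0)).Local v ×
      (cmDatum L 1 (Matrix.of fun i j : Fin 1 => if i.val + j.val + 1 = 1 then (1 : L) else 0)).Local v) := Quotient.out (ConjClasses.mk (τ t)) with hh₁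
  set h₂ : ((cmDatum L 2 (Matrix.of fun i j : Fin 2 => if i.val + j.val + 1 = 2 then (1 : L) else 0)).Local v ×
      (cmDatum L 1 (Matrix.of fun i j : Fin 1 => if i.val + j.val + 1 = 1 then (1 : L) else 0)).Local v) := Quotient.out d' with hh₂
  have hst₁ : IsLocalStablyConjH L v (τ t) h₁ := by
    have hm : ConjClasses.mk (τ t) ∈ {d : ConjClasses ((cmDatum L 2 (Matrix.of fun i j : Fin 2 => if i.val + j.val + 1 = 2 then (1 : L) else 0)).Local v ×
      (cmDatum L 1 (Matrix.of fun i j : Fin 1 => if i.val + j.val + 1 = 1 then (1 : L) else 0)).Local v) | IsLocalStablyConjH L v (τ t) (Quotient.out d)} := by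
      rw [hset]; exact Set.mem_insert _ _
    exact hm
  have hst₂ : IsLocalStablyConjH L v (τ t) h₂ := by
    have hm : d' ∈ {d : ConjClasses ((cmDatum L 2 (Matrix.of fun i j : Fin 2 => if i.val + j.val + 1 = 2 then (1 : L) else 0)).Local v ×
      (cmDatum L 1 (Matrix.of fun i j : Fin 1 => if i.val + j.val + 1 = 1 then (1 : L) else 0)).Local v) | IsLocalStablyConjH L v (τ t) (Quotient.out d)} := by
      rw [hset]; exact Set.mem_insert_of_mem _ (Set.mem_singleton _)
    exact hm
  have h₁B : h₁ ∈ B₇ := hB₇sat (τ t) htB h₁ hst₁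
  have h₂B : h₂ ∈ B₇ := hB₇sat (τ t) htB h₂ hst₂
  set c₁ : ConjClasses ((cmDatum L 3 H').Local v) := ConjClasses.mk ((θ h₁ : ↥(Subgroup.centralizer ({ε} : Set ((cmDatum L 3 H').Local v)))) : (cmDatum L 3 H').Local v) with hc₁
  set c₂ : ConjClasses ((cmDatum L 3 H').Local v) := ConjClasses.mk ((θ h₂ : ↥(Subgroup.centralizer ({ε} : Set ((cmDatum L 3 H').Local v)))) : (cmDatum L 3 H').Local v) with hc₂
  have hc₁₂ : c₁ ≠ c₂ := by
    intro heq
    obtain ⟨x, hx⟩ := isConj_iff.1 (ConjClasses.mk_eq_mk_iff_isConj.1 heq)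
    have hconj : IsConj h₁ h₂ := hsep h₁ h₁B h₂ h₂B x hx
    have e1 : ConjClasses.mk h₁ = ConjClasses.mk (τ t) := by rw [hh₁, ← ConjClasses.quotient_mk_eq_mk, Quotient.out_eq]
    have e2 : ConjClasses.mk h₂ = d' := by rw [hh₂, ← ConjClasses.quotient_mk_eq_mk, Quotient.out_eq]
    exact hd'ne (e2.symm.trans ((ConjClasses.mk_eq_mk_iff_isConj.2 hconj).symm.trans e1))
  -- every good class is one of `c₁`, `c₂`
  have hgood_sub : ∀ c : ConjClasses ((cmDatum L 3 H').Local v),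
      (∃ x : (cmDatum L 3 H').Local v, ∃ h : ((cmDatum L 2 (Matrix.of fun i j : Fin 2 => if i.val + j.val + 1 = 2 then (1 : L) else 0)).Local v ×
      (cmDatum L 1 (Matrix.of fun i j : Fin 1 => if i.val + j.val + 1 = 1 then (1 : L) else 0)).Local v), IsLocalStablyConjH L v (τ t) h ∧ x * Quotient.out c * x⁻¹ = ((θ h : ↥(Subgroup.centralizer ({ε} : Set ((cmDatum L 3 H').Local v)))) : (cmDatum L 3 H').Local v)) → c = c₁ ∨ c = c₂ := by
    rintro c ⟨x, h, hst, hx⟩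
    have hmem : ConjClasses.mk h ∈ {d : ConjClasses ((cmDatum L 2 (Matrix.of fun i j : Fin 2 => if i.val + j.val + 1 = 2 then (1 : L) else 0)).Local v ×
      (cmDatum L 1 (Matrix.of fun i j : Fin 1 => if i.val + j.val + 1 = 1 then (1 : L) else 0)).Local v) | IsLocalStablyConjH L v (τ t) (Quotient.out d)} := hstout h hst
    rw [hset, Set.mem_insert_iff, Set.mem_singleton_iff] at hmem
    have hc : c = ConjClasses.mk ((θ h : ↥(Subgroup.centralizer ({ε} : Set ((cmDatum L 3 H').Local v)))) : (cmDatum L 3 H').Local v) := by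
      rw [← Quotient.out_eq c, ConjClasses.quotient_mk_eq_mk]
      exact ConjClasses.mk_eq_mk_iff_isConj.2 (isConj_iff.2 ⟨x, hx⟩)
    obtain ⟨z, hz⟩ := houtH h
    have hθ' : ConjClasses.mk ((θ h : ↥(Subgroup.centralizer ({ε} : Set ((cmDatum L 3 H').Local v)))) : (cmDatum L 3 H').Local v) = ConjClasses.mk ((θ (Quotient.out (ConjClasses.mk h)) : ↥(Subgroup.centralizer ({ε} : Set ((cmDatum L 3 H').Local v)))) : (cmDatum L 3 H').Local v) :=
      ConjClasses.mk_eq_mk_iff_isConj.2 (hθconj _ _ (isConj_iff.2 ⟨z, hz⟩))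
    rcases hmem with hm | hm
    · left; rw [hc, hθ', hm]
    · right; rw [hc, hθ', hm]
  -- `c₁`, `c₂` are good
  have hgood₁ : ∃ x : (cmDatum L 3 H').Local v, ∃ h : ((cmDatum L 2 (Matrix.of fun i j : Fin 2 => if i.val + j.val + 1 = 2 then (1 : L) else 0)).Local v ×
      (cmDatum L 1 (Matrix.of fun i j : Fin 1 => if i.val + j.val + 1 = 1 then (1 : L) else 0)).Local v), IsLocalStablyConjH L v (τ t) h ∧ x * Quotient.out c₁ * x⁻¹ = ((θ h : ↥(Subgroup.centralizer ({ε} : Set ((cmDatum L 3 H').Local v)))) : (cmDatum L 3 H').Local v) := by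
    obtain ⟨z, hz⟩ := hout ((θ h₁ : ↥(Subgroup.centralizer ({ε} : Set ((cmDatum L 3 H').Local v)))) : (cmDatum L 3 H').Local v)
    exact ⟨z⁻¹, h₁, hst₁, by rw [hc₁, ← hz]; group⟩
  have hgood₂ : ∃ x : (cmDatum L 3 H').Local v, ∃ h : ((cmDatum L 2 (Matrix.of fun i j : Fin 2 => if i.val + j.val + 1 = 2 then (1 : L) else 0)).Local v ×
      (cmDatum L 1 (Matrix.of fun i j : Fin 1 => if i.val + j.val + 1 = 1 then (1 : L) else 0)).Local v), IsLocalStablyConjH L v (τ t) h ∧ x * Quotient.out c₂ * x⁻¹ = ((θ h : ↥(Subgroup.centralizer ({ε} : Set ((cmDatum L 3 H').Local v)))) : (cmDatum L 3 H').Local v) := by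
    obtain ⟨z, hz⟩ := hout ((θ h₂ : ↥(Subgroup.centralizer ({ε} : Set ((cmDatum L 3 H').Local v)))) : (cmDatum L 3 H').Local v)
    exact ⟨z⁻¹, h₂, hst₂, by rw [hc₂, ← hz]; group⟩
  -- the matched classes split into the good and the bad side
  set M : Set (ConjClasses ((cmDatum L 3 H').Local v)) := {c : ConjClasses ((cmDatum L 3 H').Local v) | IsLocalNormPair L H' v (t : ((cmDatum L 2 (Matrix.of fun i j : Fin 2 => if i.val + j.val + 1 = 2 then (1 : L) else 0)).Local v ×
      (cmDatum L 1 (Matrix.of fun i j : Fin 1 => if i.val + j.val + 1 = 1 then (1 : L) else 0)).Local v)) (Quotient.out c)} with hM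
  set Gd : Set (ConjClasses ((cmDatum L 3 H').Local v)) := {c : ConjClasses ((cmDatum L 3 H').Local v) |
      (∃ x : (cmDatum L 3 H').Local v, ∃ h : ((cmDatum L 2 (Matrix.of fun i j : Fin 2 => if i.val + j.val + 1 = 2 then (1 : L) else 0)).Local v ×
      (cmDatum L 1 (Matrix.of fun i j : Fin 1 => if i.val + j.val + 1 = 1 then (1 : L) else 0)).Local v), IsLocalStablyConjH L v (τ t) h ∧ x * Quotient.out c * x⁻¹ = ((θ h : ↥(Subgroup.centralizer ({ε} : Set ((cmDatum L 3 H').Local v)))) : (cmDatum L 3 H').Local v)) ∧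
        IsLocalNormPair L H' v (t : ((cmDatum L 2 (Matrix.of fun i j : Fin 2 => if i.val + j.val + 1 = 2 then (1 : L) else 0)).Local v ×
      (cmDatum L 1 (Matrix.of fun i j : Fin 1 => if i.val + j.val + 1 = 1 then (1 : L) else 0)).Local v)) (Quotient.out c)} with hGd
  set Bd : Set (ConjClasses ((cmDatum L 3 H').Local v)) := {c : ConjClasses ((cmDatum L 3 H').Local v) | Q' t (Quotient.out c) ∧ IsLocalNormPair L H' v (t : ((cmDatum L 2 (Matrix.of fun i j : Fin 2 => if i.val + j.val + 1 = 2 then (1 : L) else 0)).Local v ×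
      (cmDatum L 1 (Matrix.of fun i j : Fin 1 => if i.val + j.val + 1 = 1 then (1 : L) else 0)).Local v)) (Quotient.out c)} with hBd
  have hcover : M = Gd ∪ Bd := by
    ext c
    refine ⟨fun hm => ?_, fun hc => ?_⟩
    · rcases hsd t ht₃ htreg (Quotient.out c) hm with hg | hq
      · exact Or.inl ⟨hg, hm⟩
      · exact Or.inr ⟨hq, hm⟩
    · rcases hc with hg | hb
      · exact hg.2
      · exact hb.2
  have hdisjGB : Disjoint Gd Bd := Set.disjoint_left.2 fun c hg hb => hdj t ht₀ (Quotient.out c) hg.1 hb.1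
  have hGfin : Gd.Finite := hfin.subset fun c hc => hc.2
  have hBfin : Bd.Finite := hfin.subset fun c hc => hc.2
  -- Σ_all = Σ_matched = 0
  have hsuppM : Function.support F ⊆ M := by
    intro c hc
    rw [Function.mem_support] at hc
    by_contra hn
    apply hc
    simp only [hF, finExplicitCollection_Δ, finExplicitDelta_of_not_isLocalNormPair L v H' _ μ hn]
  have hM0 : ∑ᶠ c ∈ M, F c = 0 := by
    rw [← finsum_mem_inter_support_eq' F Set.univ M (fun x hx => ⟨fun _ => hsuppM hx, fun _ => Set.mem_univ _⟩), finsum_mem_univ]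
    exact hsum
  have hsplit : ∑ᶠ c ∈ M, F c = (∑ᶠ c ∈ Gd, F c) + ∑ᶠ c ∈ Bd, F c := by
    rw [hcover]; exact finsum_mem_union hdisjGB hGfin hBfin
  -- Σ_good = Δ‴(θ h₁) + Δ‴(θ h₂) = 0
  have hGpair : ∑ᶠ c ∈ Gd, F c = ∑ᶠ c ∈ ({c₁, c₂} : Set (ConjClasses ((cmDatum L 3 H').Local v))), F c := by
    apply finsum_mem_inter_support_eq'
    intro c hc
    rw [Function.mem_support] at hc
    have hm : IsLocalNormPair L H' v (t : ((cmDatum L 2 (Matrix.of fun i j : Fin 2 => if i.val + j.val + 1 = 2 then (1 : L) else 0)).Local v ×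
      (cmDatum L 1 (Matrix.of fun i j : Fin 1 => if i.val + j.val + 1 = 1 then (1 : L) else 0)).Local v)) (Quotient.out c) := by
      by_contra hn
      apply hc
      simp only [hF, finExplicitCollection_Δ, finExplicitDelta_of_not_isLocalNormPair L v H' _ μ hn]
    refine ⟨fun hg => ?_, fun hc12 => ?_⟩
    · rcases hgood_sub c hg.1 with h | h
      · rw [h]; exact Set.mem_insert _ _
      · rw [h]; exact Set.mem_insert_of_mem _ (Set.mem_singleton _)
    · rw [Set.mem_insert_iff, Set.mem_singleton_iff] at hc12
      rcases hc12 with h | h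
      · rw [h] at hm ⊢; exact ⟨hgood₁, hm⟩
      · rw [h] at hm ⊢; exact ⟨hgood₂, hm⟩
  have hG0 : ∑ᶠ c ∈ Gd, F c = 0 := by
    rw [hGpair, finsum_mem_pair hc₁₂, hc₁, hc₂, hFmk, hFmk, hΔneg, add_neg_cancel]
  -- conclude: Σ_bad = Σ_matched − Σ_good = 0
  have h := hM0
  rw [hsplit, hG0, zero_add] at h
  exact h

set_option maxHeartbeats 400000 in
-- 2× default: same binder telescope as §1
/-- **THE SAME WITH (ALL) DISCHARGED** over the (T) eigenframe tokens of ★ `exists_torusTransport_frame` (`A·P = P·diag(dg)`, `dg 0 = γ(ε_H) ≠ dg 1`): `hall` of §1 is ★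
`finsum_finExplicitCollection_Δ_coe_out_eq_zero_of_torusFrame` at every `G`-regular torus point (`Va := univ`), so `hΔ0` of ★ `exists_nhds_finsum_side_eq_zero_of_compact_dock` follows
from `hsep′`, `hside`, `hdisj` (★ p841663's binders) and `halt` (★ p842095's; ⇐ ★ `exists_nhds_stableClass_pair_delta_dock_eq_neg_of_frame`) alone.
[cite: Rogawski1990, §8.2 Prop. 8.2.1 (c) pp. 113–115; §4.3 (4.3.2) p. 43; §3.5 Prop. 3.5.2 (c) p. 29] [cite: LabesseLanglands1979, §2] -/
theorem exists_nhds_finsum_badSide_delta_eq_zero_of_torusFrame (w : PlacesOver L v) (hw : IsCMField.complexConj L • w.1 = w.1) (μ : HeckeCharacter L)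
    (hl : ∀ (v : HeightOneSpectrum (𝓞 ↥(maximalRealSubfield L))) (a : ((cmDatum L 2 (Matrix.of fun i j : Fin 2 => if i.val + j.val + 1 = 2 then (1 : L) else 0)).Local v ×
      (cmDatum L 1 (Matrix.of fun i j : Fin 1 => if i.val + j.val + 1 = 1 then (1 : L) else 0)).Local v)) (b : (cmDatum L 3 H').Local v) (x : ((cmDatum L 2 (Matrix.of fun i j : Fin 2 => if i.val + j.val + 1 = 2 then (1 : L) else 0)).Local v ×
      (cmDatum L 1 (Matrix.of fun i j : Fin 1 => if i.val + j.val + 1 = 1 then (1 : L) else 0)).Local v)),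
      finExplicitDelta L v H' (x * a * x⁻¹) μ b = finExplicitDelta L v H' a μ b)
    (hr : ∀ (v : HeightOneSpectrum (𝓞 ↥(maximalRealSubfield L))) (a : ((cmDatum L 2 (Matrix.of fun i j : Fin 2 => if i.val + j.val + 1 = 2 then (1 : L) else 0)).Local v ×
      (cmDatum L 1 (Matrix.of fun i j : Fin 1 => if i.val + j.val + 1 = 1 then (1 : L) else 0)).Local v)) (b y : (cmDatum L 3 H').Local v),
      finExplicitDelta L v H' a μ (y * b * y⁻¹) = finExplicitDelta L v H' a μ b)
    (hH' : (H'.map (cmConjRingHom L))ᵀ = H') (hdet' : H'.det ≠ 0)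
    (εH : ((cmDatum L 2 (Matrix.of fun i j : Fin 2 => if i.val + j.val + 1 = 2 then (1 : L) else 0)).Local v ×
      (cmDatum L 1 (Matrix.of fun i j : Fin 1 => if i.val + j.val + 1 = 1 then (1 : L) else 0)).Local v))
    {P : GL (Fin 2) (LocalRing L v)} {dg : Fin 2 → LocalRing L v}
    (hP : (εH.1.val.val : Matrix (Fin 2) (Fin 2) (LocalRing L v)) * P.val = P.val * Matrix.diagonal dg) (hdg0 : dg 0 = finGammaTwo L v εH) (hdg01 : dg 0 ≠ dg 1)
    (b₀ : ↥(Subgroup.centralizer ({εH} : Set ((cmDatum L 2 (Matrix.of fun i j : Fin 2 => if i.val + j.val + 1 = 2 then (1 : L) else 0)).Local v ×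
      (cmDatum L 1 (Matrix.of fun i j : Fin 1 => if i.val + j.val + 1 = 1 then (1 : L) else 0)).Local v))))
    (ε : (cmDatum L 3 H').Local v) (θ : ((cmDatum L 2 (Matrix.of fun i j : Fin 2 => if i.val + j.val + 1 = 2 then (1 : L) else 0)).Local v ×
      (cmDatum L 1 (Matrix.of fun i j : Fin 1 => if i.val + j.val + 1 = 1 then (1 : L) else 0)).Local v) ≃ₜ* ↥(Subgroup.centralizer ({ε} : Set ((cmDatum L 3 H').Local v))))
    (εf : ((cmDatum L 2 (Matrix.of fun i j : Fin 2 => if i.val + j.val + 1 = 2 then (1 : L) else 0)).Local v ×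
      (cmDatum L 1 (Matrix.of fun i j : Fin 1 => if i.val + j.val + 1 = 1 then (1 : L) else 0)).Local v)) (τ : ↥(Subgroup.centralizer ({εH} : Set ((cmDatum L 2 (Matrix.of fun i j : Fin 2 => if i.val + j.val + 1 = 2 then (1 : L) else 0)).Local v ×
      (cmDatum L 1 (Matrix.of fun i j : Fin 1 => if i.val + j.val + 1 = 1 then (1 : L) else 0)).Local v))) → ((cmDatum L 2 (Matrix.of fun i j : Fin 2 => if i.val + j.val + 1 = 2 then (1 : L) else 0)).Local v ×
      (cmDatum L 1 (Matrix.of fun i j : Fin 1 => if i.val + j.val + 1 = 1 then (1 : L) else 0)).Local v)) (hτc : Continuous τ) (hτ₀ : τ b₀ = εf)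
    (Q' : ↥(Subgroup.centralizer ({εH} : Set ((cmDatum L 2 (Matrix.of fun i j : Fin 2 => if i.val + j.val + 1 = 2 then (1 : L) else 0)).Local v ×
      (cmDatum L 1 (Matrix.of fun i j : Fin 1 => if i.val + j.val + 1 = 1 then (1 : L) else 0)).Local v))) → (cmDatum L 3 H').Local v → Prop)
    (hsep' : ∃ B₇ ∈ 𝓝 εf, (∀ h ∈ B₇, ∀ h' : ((cmDatum L 2 (Matrix.of fun i j : Fin 2 => if i.val + j.val + 1 = 2 then (1 : L) else 0)).Local v ×
      (cmDatum L 1 (Matrix.of fun i j : Fin 1 => if i.val + j.val + 1 = 1 then (1 : L) else 0)).Local v), IsLocalStablyConjH L v h h' → h' ∈ B₇) ∧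
      ∀ h ∈ B₇, ∀ h' ∈ B₇, ∀ x : (cmDatum L 3 H').Local v, x * ((θ h : ↥(Subgroup.centralizer ({ε} : Set ((cmDatum L 3 H').Local v)))) : (cmDatum L 3 H').Local v) * x⁻¹ = ((θ h' : ↥(Subgroup.centralizer ({ε} : Set ((cmDatum L 3 H').Local v)))) : (cmDatum L 3 H').Local v) → IsConj h h')
    (hside : ∃ V₃ ∈ 𝓝 b₀, ∀ t ∈ V₃, IsLocalGRegular L v (t : ((cmDatum L 2 (Matrix.of fun i j : Fin 2 => if i.val + j.val + 1 = 2 then (1 : L) else 0)).Local v ×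
      (cmDatum L 1 (Matrix.of fun i j : Fin 1 => if i.val + j.val + 1 = 1 then (1 : L) else 0)).Local v)) → ∀ γ' : (cmDatum L 3 H').Local v, IsLocalNormPair L H' v (t : ((cmDatum L 2 (Matrix.of fun i j : Fin 2 => if i.val + j.val + 1 = 2 then (1 : L) else 0)).Local v ×
      (cmDatum L 1 (Matrix.of fun i j : Fin 1 => if i.val + j.val + 1 = 1 then (1 : L) else 0)).Local v)) γ' →
      (∃ x : (cmDatum L 3 H').Local v, ∃ h : ((cmDatum L 2 (Matrix.of fun i j : Fin 2 => if i.val + j.val + 1 = 2 then (1 : L) else 0)).Local v ×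
      (cmDatum L 1 (Matrix.of fun i j : Fin 1 => if i.val + j.val + 1 = 1 then (1 : L) else 0)).Local v), IsLocalStablyConjH L v (τ t) h ∧ x * γ' * x⁻¹ = ((θ h : ↥(Subgroup.centralizer ({ε} : Set ((cmDatum L 3 H').Local v)))) : (cmDatum L 3 H').Local v)) ∨ Q' t γ')
    (hdisj : ∃ V₀ ∈ 𝓝 b₀, ∀ t ∈ V₀, ∀ γ' : (cmDatum L 3 H').Local v,
      (∃ x : (cmDatum L 3 H').Local v, ∃ h : ((cmDatum L 2 (Matrix.of fun i j : Fin 2 => if i.val + j.val + 1 = 2 then (1 : L) else 0)).Local v ×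
      (cmDatum L 1 (Matrix.of fun i j : Fin 1 => if i.val + j.val + 1 = 1 then (1 : L) else 0)).Local v), IsLocalStablyConjH L v (τ t) h ∧ x * γ' * x⁻¹ = ((θ h : ↥(Subgroup.centralizer ({ε} : Set ((cmDatum L 3 H').Local v)))) : (cmDatum L 3 H').Local v)) → Q' t γ' → False)
    (halt : ∃ V₁ ∈ 𝓝 b₀, ∀ t ∈ V₁, IsLocalGRegular L v (t : ((cmDatum L 2 (Matrix.of fun i j : Fin 2 => if i.val + j.val + 1 = 2 then (1 : L) else 0)).Local v ×
      (cmDatum L 1 (Matrix.of fun i j : Fin 1 => if i.val + j.val + 1 = 1 then (1 : L) else 0)).Local v)) → ∃ d' : ConjClasses ((cmDatum L 2 (Matrix.of fun i j : Fin 2 => if i.val + j.val + 1 = 2 then (1 : L) else 0)).Local v ×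
      (cmDatum L 1 (Matrix.of fun i j : Fin 1 => if i.val + j.val + 1 = 1 then (1 : L) else 0)).Local v), d' ≠ ConjClasses.mk (τ t) ∧
        {d : ConjClasses ((cmDatum L 2 (Matrix.of fun i j : Fin 2 => if i.val + j.val + 1 = 2 then (1 : L) else 0)).Local v ×
      (cmDatum L 1 (Matrix.of fun i j : Fin 1 => if i.val + j.val + 1 = 1 then (1 : L) else 0)).Local v) | IsLocalStablyConjH L v (τ t) (Quotient.out d)} = {ConjClasses.mk (τ t), d'} ∧
        ((finExplicitCollection L H' μ hl hr) v).Δ (t : ((cmDatum L 2 (Matrix.of fun i j : Fin 2 => if i.val + j.val + 1 = 2 then (1 : L) else 0)).Local v ×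
      (cmDatum L 1 (Matrix.of fun i j : Fin 1 => if i.val + j.val + 1 = 1 then (1 : L) else 0)).Local v)) ((θ (Quotient.out d') : ↥(Subgroup.centralizer ({ε} : Set ((cmDatum L 3 H').Local v)))) : (cmDatum L 3 H').Local v) =
          - ((finExplicitCollection L H' μ hl hr) v).Δ (t : ((cmDatum L 2 (Matrix.of fun i j : Fin 2 => if i.val + j.val + 1 = 2 then (1 : L) else 0)).Local v ×
      (cmDatum L 1 (Matrix.of fun i j : Fin 1 => if i.val + j.val + 1 = 1 then (1 : L) else 0)).Local v)) ((θ (Quotient.out (ConjClasses.mk (τ t))) : ↥(Subgroup.centralizer ({ε} : Set ((cmDatum L 3 H').Local v)))) : (cmDatum L 3 H').Local v)) :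
    ∃ V ∈ 𝓝 b₀, ∀ t ∈ V, IsLocalGRegular L v (t : ((cmDatum L 2 (Matrix.of fun i j : Fin 2 => if i.val + j.val + 1 = 2 then (1 : L) else 0)).Local v ×
      (cmDatum L 1 (Matrix.of fun i j : Fin 1 => if i.val + j.val + 1 = 1 then (1 : L) else 0)).Local v)) →
      (∑ᶠ c ∈ {c : ConjClasses ((cmDatum L 3 H').Local v) | Q' t (Quotient.out c) ∧ IsLocalNormPair L H' v (t : ((cmDatum L 2 (Matrix.of fun i j : Fin 2 => if i.val + j.val + 1 = 2 then (1 : L) else 0)).Local v ×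
      (cmDatum L 1 (Matrix.of fun i j : Fin 1 => if i.val + j.val + 1 = 1 then (1 : L) else 0)).Local v)) (Quotient.out c)},
        ((finExplicitCollection L H' μ hl hr) v).Δ (t : ((cmDatum L 2 (Matrix.of fun i j : Fin 2 => if i.val + j.val + 1 = 2 then (1 : L) else 0)).Local v ×
      (cmDatum L 1 (Matrix.of fun i j : Fin 1 => if i.val + j.val + 1 = 1 then (1 : L) else 0)).Local v)) (Quotient.out c)) = 0 :=
  exists_nhds_finsum_badSide_delta_eq_zero L H' v μ hl hr εH b₀ ε θ εf τ hτc hτ₀ Q' hsep' hside hdisj halt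
    ⟨Set.univ, Filter.univ_mem, fun t _ ht => finsum_finExplicitCollection_Δ_coe_out_eq_zero_of_torusFrame L H' v w hw μ hl hr hH' hdet' εH hP hdg0 hdg01 t ht⟩

end BadSide

end Literature.NumberTheory.Rogawski1990

end
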